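import Summits.CriticalPhenomena.PercolationContinuityZ3.Theses.PercNearOneGluing
import Summits.CriticalPhenomena.PercolationContinuityZ3.Theorems.PercNearOneGluingAdditiveGluingML5EdgeIdentity
import Literature.Probability.Percolation.TwoSetExchange
import Literature.Probability.Percolation.KozmaNitzanPreFKG
import HarnessLib

/-!
# Crux `PercNearOneGluing.AdditiveGluing` (stmt-CriticalPhenomena-4576), line `tieline`: the three-point transfer (3PT)

Support file (`--supports stmt-CriticalPhenomena-4576`, helper, lead c11).  No definitions, no named facts, no sorries.

Weighted graph on `Fin n` (`μ = prodBernoulli w`), relays `u, v`, observer `o`, spectator `c`; `D = {u ↮ v}`,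
`N = {c ↮ u} ∩ {c ↮ v}` ("`c` free"), `L = C_v`.  The registered kernel stub `stub_k0CovTransferQ_c9` = (T) of the
three-relay half says that, given `u ↮ v`, the (negative) correlation of `{b ∈ C_u}` with `{x ∈ C_v}` at `x = o` is at least
`π = P(o ↔ c | u ↮ v, c free)` times the one at `x = c`; equivalently (lead c11) the law of `C_v` given `u ↮ v`, tilted by
`1{o ∈ C_v} + π·1{c ∉ C_v}`, should dominate the untilted law.  This file proves the instance of that dominance at the
up-set `{c ∈ C_v}`, the **three-point transfer**

  (3PT)  `P_D(o ∈ L | c ∈ L) − P_D(o ∈ L | c ∉ L) ≥ P_D(o ↔ c | c ↮ u, c ↮ v)`,  `P_D = P( · | u ↮ v)`,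

in the division-free form
`μ(D ∩ N ∩ {o↔c}) · μ(D ∩ {v↔c}) · μ(D ∩ {v↮c}) ≤ μ(D ∩ N) · (μ(D)·μ(D ∩ {v↔o} ∩ {v↔c}) − μ(D ∩ {v↔o})·μ(D ∩ {v↔c}))`.

Proof (two applications of van den Berg–Häggström–Kahn, Thm. 2.1 at `q = 1` = Thm. 1.5 with vertex sets, in the tree
`setTwoClusterExchange` / `guardedTwoClusterExchange`):
* (I) the set cluster `S = C_{{v,c}}` is positively associated given `u ∉ S`: the events `{v ↔ c}` and `{o ∈ S}` are both
  increasing in `S`, whence `μ(D ∩ v↔c ∩ v↔o)·μ({u∉S}) ≥ μ(D ∩ v↔c)·μ({u∉S} ∩ {o∈S})`, and on `{u ∉ S} ∩ {v ↮ c} = D ∩ N`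
  the event `{o ∈ S}` splits into `{v ↔ o}` and `{o ↔ c}`;
* (II) `C_v` is positively associated given `C_v ∩ {u,c} = ∅`, and `{v ↔ o}`, `{u ↮ c}` are both of type `(+)`:
  `μ(D ∩ v↮c ∩ v↔o)·μ(D ∩ N) ≤ μ(D ∩ N ∩ v↔o)·μ(D ∩ v↮c)`;
then linear arithmetic.
[cite: VandenbergHaggstromKahn2005, Thm. 1.3 (p. 6), Thm. 1.5 (p. 7), Thm. 2.1 (p. 9) with Remark 1 after Thm. 1.2 (p. 5)]
[cite: KozmaNitzan2024, Lemma 4 (p. 9), Question 7 (p. 36)]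
-/

namespace Summit.CriticalPhenomena.PercolationContinuityZ3.Cruxes.AdditiveGluing.TieLine

open MeasureTheory Set Literature.Probability.LatticeModels Literature.Probability.Percolation
open Summit.CriticalPhenomena.PercolationContinuityZ3.Theorems

noncomputable section

namespace ThreePointTransfer

variable {n : ℕ}

/-- `{S ↮ T}` for `S = {v, c}`, `T = {u}` is `{v ↮ u} ∩ {c ↮ u}`. [folklore] -/
theorem sep_vc_u_eq (u v c : Fin n) :
    {ω : BondConfig (Fin n) | ∀ s ∈ ({v, c} : Set (Fin n)), ∀ t ∈ ({u} : Set (Fin n)), ¬ (openGraph ω).Reachable s t} =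
      (openConn v u)ᶜ ∩ (openConn c u)ᶜ := by
  ext ω
  simp only [mem_setOf_eq, mem_insert_iff, mem_singleton_iff, forall_eq_or_imp, forall_eq, mem_inter_iff,
    mem_compl_iff, openConn]

/-- `{S ↮ T}` for `S = {v}`, `T = {u, c}` is `{v ↮ u} ∩ {v ↮ c}`. [folklore] -/
theorem sep_v_uc_eq (u v c : Fin n) :
    {ω : BondConfig (Fin n) | ∀ s ∈ ({v} : Set (Fin n)), ∀ t ∈ ({u, c} : Set (Fin n)), ¬ (openGraph ω).Reachable s t} =
      (openConn v u)ᶜ ∩ (openConn v c)ᶜ := by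
  ext ω
  simp only [mem_setOf_eq, mem_insert_iff, mem_singleton_iff, forall_eq_or_imp, forall_eq, mem_inter_iff,
    mem_compl_iff, openConn]

/-- **(I)** Set-BHK for `S = {v,c}`, `T = {u}`: `μ({u∉S} ∩ v↔c) · μ({u∉S} ∩ {o ∈ S}) ≤ μ({u∉S} ∩ v↔c ∩ {o∈S}) · μ({u∉S})`,
`{o ∈ S} = {v↔o} ∪ {c↔o}`. [cite: VandenbergHaggstromKahn2005, Thm. 2.1 (p. 9) at q = 1] -/
theorem stepI (w : Sym2 (Fin n) → unitInterval) (o u v c : Fin n) :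
    (prodBernoulli w).real ((openConn v u)ᶜ ∩ (openConn c u)ᶜ ∩ openConn v c) *
        (prodBernoulli w).real ((openConn v u)ᶜ ∩ (openConn c u)ᶜ ∩
          ⋃ s ∈ ({v, c} : Set (Fin n)), (openConn s o : Set (BondConfig (Fin n)))) ≤
      (prodBernoulli w).real ((openConn v u)ᶜ ∩ (openConn c u)ᶜ ∩
          (openConn v c ∩ ⋃ s ∈ ({v, c} : Set (Fin n)), (openConn s o : Set (BondConfig (Fin n))))) *
        (prodBernoulli w).real ((openConn v u)ᶜ ∩ (openConn c u)ᶜ : Set (BondConfig (Fin n))) := by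
  have key := setTwoClusterExchange w ({v, c} : Set (Fin n)) ({u} : Set (Fin n))
    (A₁ := openConn v c) (A₂ := ⋃ s ∈ ({v, c} : Set (Fin n)), (openConn s o : Set (BondConfig (Fin n))))
    (B₁ := univ) (B₂ := univ)
    (TwoSetExchange.typePlus_openConn_of_mem ({v, c} : Set (Fin n)) ({u} : Set (Fin n)) (s₀ := v) (by simp) c)
    (TwoSetExchange.typePlus_biUnion_openConn _ _ o)
    (fun _ _ _ _ _ => mem_univ _) (fun _ _ _ _ _ => mem_univ _)
  simpa only [sep_vc_u_eq, inter_univ, univ_inter] using key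

/-- **(II)** Guarded BHK for `S = {v}`, `T = {u,c}`, pair `(v,u)`: `{v↔o}` and `{u↮c}` are of type `(+)`, so
`μ({v↮u,v↮c} ∩ v↔o) · μ({v↮u,v↮c} ∩ u↮c) ≤ μ({v↮u,v↮c} ∩ (v↔o ∩ u↮c)) · μ({v↮u,v↮c})`.
[cite: VandenbergHaggstromKahn2005, Thm. 1.3 (p. 6), Thm. 2.1 (p. 9) at q = 1] -/
theorem stepII (w : Sym2 (Fin n) → unitInterval) (o u v c : Fin n) :
    (prodBernoulli w).real ((openConn v u)ᶜ ∩ (openConn v c)ᶜ ∩ openConn v o) *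
        (prodBernoulli w).real ((openConn v u)ᶜ ∩ (openConn v c)ᶜ ∩ (openConn u c)ᶜ) ≤
      (prodBernoulli w).real ((openConn v u)ᶜ ∩ (openConn v c)ᶜ ∩ (openConn v o ∩ (openConn u c)ᶜ)) *
        (prodBernoulli w).real ((openConn v u)ᶜ ∩ (openConn v c)ᶜ : Set (BondConfig (Fin n))) := by
  have key := guardedTwoClusterExchange w ({v} : Set (Fin n)) ({u, c} : Set (Fin n)) (s := v) (t := u)
    (by simp) (by simp)
    (A₁ := openConn v o) (A₂ := (openConn u c)ᶜ) (B₁ := univ) (B₂ := univ)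
    (typePlus_openConn v u o) (typePlus_not_openConn v u c)
    (fun _ _ _ _ _ => mem_univ _) (fun _ _ _ _ _ => mem_univ _)
  simpa only [sep_v_uc_eq, inter_univ, univ_inter] using key

/-! ### Set identities -/

/-- `{v↮u} ∩ {c↮u} ∩ {v↔c} = D ∩ {v↔c}` (`v ↔ c` and `u ↮ v` force `c ↮ u`). [folklore] -/
theorem I_left_eq (u v c : Fin n) :
    ((openConn v u)ᶜ ∩ (openConn c u)ᶜ ∩ openConn v c : Set (BondConfig (Fin n))) = (openConn u v)ᶜ ∩ openConn v c := by
  ext ω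
  simp only [mem_inter_iff, mem_compl_iff, openConn, mem_setOf_eq]
  constructor
  · rintro ⟨⟨hvu, -⟩, hvc⟩
    exact ⟨fun huv => hvu huv.symm, hvc⟩
  · rintro ⟨huv, hvc⟩
    exact ⟨⟨fun hvu => huv hvu.symm, fun hcu => huv (hvc.trans hcu).symm⟩, hvc⟩

/-- `{v↮u} ∩ {c↮u} ∩ ({v↔c} ∩ {o ∈ S}) = D ∩ {v↔o} ∩ {v↔c}`. [folklore] -/
theorem I_mid_eq (o u v c : Fin n) :
    ((openConn v u)ᶜ ∩ (openConn c u)ᶜ ∩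
        (openConn v c ∩ ⋃ s ∈ ({v, c} : Set (Fin n)), (openConn s o : Set (BondConfig (Fin n)))) : Set (BondConfig (Fin n))) =
      (openConn u v)ᶜ ∩ openConn v o ∩ openConn v c := by
  ext ω
  simp only [mem_inter_iff, mem_compl_iff, mem_iUnion, mem_insert_iff, mem_singleton_iff, exists_prop, openConn,
    mem_setOf_eq]
  constructor
  · rintro ⟨⟨hvu, -⟩, hvc, s, hs, hso⟩
    refine ⟨⟨fun huv => hvu huv.symm, ?_⟩, hvc⟩
    rcases hs with rfl | rfl
    · exact hso
    · exact hvc.trans hso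
  · rintro ⟨⟨huv, hvo⟩, hvc⟩
    exact ⟨⟨fun hvu => huv hvu.symm, fun hcu => huv (hvc.trans hcu).symm⟩, hvc, v, Or.inl rfl, hvo⟩

/-- `{v↮u} ∩ {c↮u} ∩ {v↮c} = D ∩ N`. [folklore] -/
theorem I_free_eq (u v c : Fin n) :
    ((openConn v u)ᶜ ∩ (openConn c u)ᶜ ∩ (openConn v c)ᶜ : Set (BondConfig (Fin n))) =
      (openConn u v)ᶜ ∩ ((openConn c u)ᶜ ∩ (openConn c v)ᶜ) := by
  ext ω
  simp only [mem_inter_iff, mem_compl_iff, openConn, mem_setOf_eq]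
  constructor
  · rintro ⟨⟨hvu, hcu⟩, hvc⟩
    exact ⟨fun huv => hvu huv.symm, hcu, fun hcv => hvc hcv.symm⟩
  · rintro ⟨huv, hcu, hcv⟩
    exact ⟨⟨fun hvu => huv hvu.symm, hcu⟩, fun hvc => hcv hvc.symm⟩

/-- `μ({v↮u} ∩ {c↮u}) = μ(D ∩ v↔c) + μ(D ∩ N)`. [folklore] -/
theorem real_I_right_eq (w : Sym2 (Fin n) → unitInterval) (u v c : Fin n) :
    (prodBernoulli w).real ((openConn v u)ᶜ ∩ (openConn c u)ᶜ : Set (BondConfig (Fin n))) =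
      (prodBernoulli w).real ((openConn u v)ᶜ ∩ openConn v c : Set (BondConfig (Fin n))) +
        (prodBernoulli w).real ((openConn u v)ᶜ ∩ ((openConn c u)ᶜ ∩ (openConn c v)ᶜ) : Set (BondConfig (Fin n))) := by
  rw [ML5EdgeIdentity.real_eq_inter_add_inter_compl w ((openConn v u)ᶜ ∩ (openConn c u)ᶜ : Set (BondConfig (Fin n)))
    (openConn v c), I_left_eq, I_free_eq]

/-- Lower bound for `μ({v↮u} ∩ {c↮u} ∩ {o ∈ S})`: the three events `D ∩ v↔o ∩ v↔c`, `D ∩ N ∩ v↔o`, `D ∩ N ∩ o↔c` are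
pairwise disjoint subsets. [folklore] -/
theorem real_I_obs_ge (w : Sym2 (Fin n) → unitInterval) (o u v c : Fin n) :
    (prodBernoulli w).real ((openConn u v)ᶜ ∩ openConn v o ∩ openConn v c : Set (BondConfig (Fin n))) +
          (prodBernoulli w).real ((openConn u v)ᶜ ∩ ((openConn c u)ᶜ ∩ (openConn c v)ᶜ) ∩ openConn v o : Set (BondConfig (Fin n))) +
        (prodBernoulli w).real ((openConn u v)ᶜ ∩ ((openConn c u)ᶜ ∩ (openConn c v)ᶜ) ∩ openConn o c : Set (BondConfig (Fin n))) ≤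
      (prodBernoulli w).real ((openConn v u)ᶜ ∩ (openConn c u)ᶜ ∩
          ⋃ s ∈ ({v, c} : Set (Fin n)), (openConn s o : Set (BondConfig (Fin n)))) := by
  set X1 : Set (BondConfig (Fin n)) := (openConn u v)ᶜ ∩ openConn v o ∩ openConn v c with hX1
  set X2 : Set (BondConfig (Fin n)) := (openConn u v)ᶜ ∩ ((openConn c u)ᶜ ∩ (openConn c v)ᶜ) ∩ openConn v o with hX2
  set X3 : Set (BondConfig (Fin n)) := (openConn u v)ᶜ ∩ ((openConn c u)ᶜ ∩ (openConn c v)ᶜ) ∩ openConn o c with hX3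
  have hd12 : Disjoint X1 X2 := by
    rw [Set.disjoint_left]
    rintro ω ⟨⟨-, -⟩, hvc⟩ ⟨⟨-, -, hcv⟩, -⟩
    exact hcv (show (openGraph ω).Reachable c v from hvc.symm)
  have hd13 : Disjoint X1 X3 := by
    rw [Set.disjoint_left]
    rintro ω ⟨⟨-, -⟩, hvc⟩ ⟨⟨-, -, hcv⟩, -⟩
    exact hcv (show (openGraph ω).Reachable c v from hvc.symm)
  have hd23 : Disjoint X2 X3 := by
    rw [Set.disjoint_left]
    rintro ω ⟨⟨-, -, hcv⟩, hvo⟩ ⟨-, hoc⟩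
    exact hcv (show (openGraph ω).Reachable c v from (hvo.trans hoc).symm)
  have hsub : X1 ∪ X2 ∪ X3 ⊆ ((openConn v u)ᶜ ∩ (openConn c u)ᶜ ∩
      ⋃ s ∈ ({v, c} : Set (Fin n)), (openConn s o : Set (BondConfig (Fin n)))) := by
    intro ω hω
    simp only [hX1, hX2, hX3, mem_union, mem_inter_iff, mem_compl_iff, openConn, mem_setOf_eq] at hω
    simp only [mem_inter_iff, mem_compl_iff, mem_iUnion, mem_insert_iff, mem_singleton_iff, exists_prop, openConn,
      mem_setOf_eq]
    rcases hω with (⟨⟨huv, hvo⟩, hvc⟩ | ⟨⟨huv, hcu, -⟩, hvo⟩) | ⟨⟨huv, hcu, -⟩, hoc⟩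
    · exact ⟨⟨fun hvu => huv hvu.symm, fun hcu => huv (hvc.trans hcu).symm⟩, v, Or.inl rfl, hvo⟩
    · exact ⟨⟨fun hvu => huv hvu.symm, hcu⟩, v, Or.inl rfl, hvo⟩
    · exact ⟨⟨fun hvu => huv hvu.symm, hcu⟩, c, Or.inr rfl, hoc.symm⟩
  have hm : ∀ s : Set (BondConfig (Fin n)), MeasurableSet s := fun s => (Set.toFinite s).measurableSet
  calc (prodBernoulli w).real X1 + (prodBernoulli w).real X2 + (prodBernoulli w).real X3
      = (prodBernoulli w).real (X1 ∪ X2 ∪ X3) := by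
        rw [measureReal_union (hd13.union_left hd23) (hm _), measureReal_union hd12 (hm _)]
    _ ≤ _ := measureReal_mono hsub

/-- `{v↮u} ∩ {v↮c} = D ∩ {v↮c}`. [folklore] -/
theorem II_base_eq (u v c : Fin n) :
    ((openConn v u)ᶜ ∩ (openConn v c)ᶜ : Set (BondConfig (Fin n))) = (openConn u v)ᶜ ∩ (openConn v c)ᶜ := by
  rw [KNPreFKG.openConn_symm v u]

/-- `{v↮u} ∩ {v↮c} ∩ {u↮c} = D ∩ N`. [folklore] -/
theorem II_free_eq (u v c : Fin n) :
    ((openConn v u)ᶜ ∩ (openConn v c)ᶜ ∩ (openConn u c)ᶜ : Set (BondConfig (Fin n))) =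
      (openConn u v)ᶜ ∩ ((openConn c u)ᶜ ∩ (openConn c v)ᶜ) := by
  rw [KNPreFKG.openConn_symm v u, KNPreFKG.openConn_symm v c, KNPreFKG.openConn_symm u c, inter_assoc,
    inter_comm ((openConn c v)ᶜ)]

/-- `{v↮u} ∩ {v↮c} ∩ ({v↔o} ∩ {u↮c}) = D ∩ N ∩ {v↔o}`. [folklore] -/
theorem II_mid_eq (o u v c : Fin n) :
    ((openConn v u)ᶜ ∩ (openConn v c)ᶜ ∩ (openConn v o ∩ (openConn u c)ᶜ) : Set (BondConfig (Fin n))) =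
      (openConn u v)ᶜ ∩ ((openConn c u)ᶜ ∩ (openConn c v)ᶜ) ∩ openConn v o := by
  rw [← II_free_eq u v c]
  ext ω
  simp only [mem_inter_iff]
  tauto

/-- `{v↮u} ∩ {v↮c} ∩ {v↔o} = D ∩ {v↮c} ∩ {v↔o}`. [folklore] -/
theorem II_left_eq (o u v c : Fin n) :
    ((openConn v u)ᶜ ∩ (openConn v c)ᶜ ∩ openConn v o : Set (BondConfig (Fin n))) =
      (openConn u v)ᶜ ∩ (openConn v c)ᶜ ∩ openConn v o := by
  rw [KNPreFKG.openConn_symm v u]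

/-- `μ(D) = μ(D ∩ v↔c) + μ(D ∩ v↮c)` and `μ(D ∩ v↔o) = μ(D ∩ v↔o ∩ v↔c) + μ(D ∩ v↮c ∩ v↔o)`. [folklore] -/
theorem real_D_split (w : Sym2 (Fin n) → unitInterval) (o u v c : Fin n) :
    (prodBernoulli w).real ((openConn u v)ᶜ : Set (BondConfig (Fin n))) =
        (prodBernoulli w).real ((openConn u v)ᶜ ∩ openConn v c : Set (BondConfig (Fin n))) +
          (prodBernoulli w).real ((openConn u v)ᶜ ∩ (openConn v c)ᶜ : Set (BondConfig (Fin n))) ∧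
      (prodBernoulli w).real ((openConn u v)ᶜ ∩ openConn v o : Set (BondConfig (Fin n))) =
        (prodBernoulli w).real ((openConn u v)ᶜ ∩ openConn v o ∩ openConn v c : Set (BondConfig (Fin n))) +
          (prodBernoulli w).real ((openConn u v)ᶜ ∩ (openConn v c)ᶜ ∩ openConn v o : Set (BondConfig (Fin n))) := by
  refine ⟨ML5EdgeIdentity.real_eq_inter_add_inter_compl w _ _, ?_⟩
  rw [ML5EdgeIdentity.real_eq_inter_add_inter_compl w ((openConn u v)ᶜ ∩ openConn v o : Set (BondConfig (Fin n)))
    (openConn v c), inter_right_comm ((openConn u v)ᶜ) (openConn v o) ((openConn v c)ᶜ)]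

end ThreePointTransfer

open ThreePointTransfer in
/-- **Three-point transfer (3PT)** (line `tieline`, crux `AdditiveGluing`; lead c11): with `D = {u ↮ v}`,
`N = {c ↮ u} ∩ {c ↮ v}`:
`μ(D ∩ N ∩ {o↔c}) · μ(D ∩ {v↔c}) · μ(D ∩ {v↮c}) ≤ μ(D ∩ N) · (μ(D)·μ(D ∩ {v↔o} ∩ {v↔c}) − μ(D ∩ {v↔o})·μ(D ∩ {v↔c}))`,
i.e. `Cov_D(1{o∈C_v}, 1{c∈C_v}) ≥ P_D(o↔c | c free)·Var_D(1{c∈C_v})`: the instance `U = {c ∈ C_v}` of the dominance form of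
the kernel stub `stub_k0CovTransferQ_c9`.  Two set-BHK exchanges (`stepI`, `stepII`) and linear arithmetic.
[cite: VandenbergHaggstromKahn2005, Thm. 1.3 (p. 6), Thm. 1.5 (p. 7), Thm. 2.1 (p. 9)] [cite: KozmaNitzan2024, Question 7 (p. 36)] -/
theorem threePointTransfer : ∀ (n : ℕ) (w : Sym2 (Fin n) → unitInterval) (o u v c : Fin n),
    (prodBernoulli w).real ((openConn u v)ᶜ ∩ ((openConn c u)ᶜ ∩ (openConn c v)ᶜ) ∩ openConn o c : Set (BondConfig (Fin n))) *
        ((prodBernoulli w).real ((openConn u v)ᶜ ∩ openConn v c : Set (BondConfig (Fin n))) *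
          (prodBernoulli w).real ((openConn u v)ᶜ ∩ (openConn v c)ᶜ : Set (BondConfig (Fin n)))) ≤
      (prodBernoulli w).real ((openConn u v)ᶜ ∩ ((openConn c u)ᶜ ∩ (openConn c v)ᶜ) : Set (BondConfig (Fin n))) *
        ((prodBernoulli w).real ((openConn u v)ᶜ : Set (BondConfig (Fin n))) *
            (prodBernoulli w).real ((openConn u v)ᶜ ∩ openConn v o ∩ openConn v c : Set (BondConfig (Fin n))) -
          (prodBernoulli w).real ((openConn u v)ᶜ ∩ openConn v o : Set (BondConfig (Fin n))) *
            (prodBernoulli w).real ((openConn u v)ᶜ ∩ openConn v c : Set (BondConfig (Fin n)))) := by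
  intro n w o u v c
  have hI := stepI w o u v c
  have hII := stepII w o u v c
  rw [I_left_eq u v c, I_mid_eq o u v c, real_I_right_eq w u v c] at hI
  rw [II_left_eq o u v c, II_free_eq u v c, II_mid_eq o u v c, II_base_eq u v c] at hII
  have hge := real_I_obs_ge w o u v c
  obtain ⟨hD, hDo⟩ := real_D_split w o u v c
  set μ := prodBernoulli w with hμ
  set poc := μ.real ((openConn u v)ᶜ ∩ openConn v o ∩ openConn v c : Set (BondConfig (Fin n))) with hpoc
  set pc := μ.real ((openConn u v)ᶜ ∩ openConn v c : Set (BondConfig (Fin n))) with hpc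
  set pcb := μ.real ((openConn u v)ᶜ ∩ (openConn v c)ᶜ : Set (BondConfig (Fin n))) with hpcb
  set t := μ.real ((openConn u v)ᶜ ∩ ((openConn c u)ᶜ ∩ (openConn c v)ᶜ) : Set (BondConfig (Fin n))) with ht
  set tov := μ.real ((openConn u v)ᶜ ∩ ((openConn c u)ᶜ ∩ (openConn c v)ᶜ) ∩ openConn v o : Set (BondConfig (Fin n)))
    with htov
  set toc := μ.real ((openConn u v)ᶜ ∩ ((openConn c u)ᶜ ∩ (openConn c v)ᶜ) ∩ openConn o c : Set (BondConfig (Fin n)))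
    with htoc
  set pocb := μ.real ((openConn u v)ᶜ ∩ (openConn v c)ᶜ ∩ openConn v o : Set (BondConfig (Fin n))) with hpocb
  set obs := μ.real ((openConn v u)ᶜ ∩ (openConn c u)ᶜ ∩
    ⋃ s ∈ ({v, c} : Set (Fin n)), (openConn s o : Set (BondConfig (Fin n)))) with hobs
  -- hI : pc * obs ≤ poc * (pc + t);  hge : poc + tov + toc ≤ obs;  hII : pocb * t ≤ tov * pcb
  rw [hD, hDo]
  have hpc0 : 0 ≤ pc := measureReal_nonneg
  have hpcb0 : 0 ≤ pcb := measureReal_nonneg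
  have h1 : pc * (poc + tov + toc) ≤ poc * (pc + t) := (mul_le_mul_of_nonneg_left hge hpc0).trans hI
  nlinarith [mul_le_mul_of_nonneg_left h1 hpcb0, mul_le_mul_of_nonneg_left hII hpc0]

end

end Summit.CriticalPhenomena.PercolationContinuityZ3.Cruxes.AdditiveGluing.TieLine
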